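import Literature.Geometry.Lorentzian.FinalState
import Literature.Geometry.Lorentzian.TameGenericity
import Literature.Geometry.Lorentzian.TameGenericityLocal
import Literature.Geometry.Lorentzian.AsymptoticFlatness
import Literature.Geometry.Lorentzian.TameBreathingCurve
import Literature.Geometry.Lorentzian.AFEndRestrict
import HarnessLib

/-!
# Helpers for stub `stub_broom` of line `Sketch` of crux `HonestFixedRadiusSettlingT`
# (stmt-FinalStateConjecture-17575): the far-CLEAN case and arc-locality of the broom

The registered stub `stub_broom` asks, through EVERY admissible datum `d ∈ admissibleVacuumData X`,
for a tame (`InitialDataSet.IsTameDataFamily e 1 F`), immersed (`IsImmersedAtZero 1 F`), injective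
curve of ADMISSIBLE data with `F 0 = d` whose members off `0` are far-clean to order `(6, 5)` on the
same end, `e.IsStronglyAsymptoticallyFlatWith (F c) M 1 2 6 5`. The general case is weighted elliptic
theory for the vacuum constraint map on asymptotically flat ends (Chruściel–Delay 2003, §7;
Corvino–Schoen 2006; Mao–Oh–Tao 2023), absent from the tree. This support file records the two
bookkeeping facts that ARE free over the tree:

* `broom_of_farClean` — if `d` is admissible and ITSELF far-clean to order `(6, 5)` on a sole end `e`,
  the breathing curve of `d` (`AFEnd.breatheFamily`, `TameBreathingCurve.lean`), read on a collared
  restriction of `e`, is a broom: its members are isometric copies of `d` agreeing with `d` off a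
  compact set, hence far-clean with the same mass (`IsStronglyAsymptoticallyFlatWith.congr_of_eqOn_far`,
  `isStronglyAsymptoticallyFlatWith_restrict_iff`);
* `broom_of_local` — arc-locality: far-clean members for `0 < ‖c‖ < ε` suffice
  (`InitialDataSet.exists_tameFamily_of_local`).

No definitions, no named facts, no `sorry`.
-/

set_option linter.dupNamespace false

noncomputable section

open scoped Manifold ContDiff Topology
open Filter Set Function Literature.Geometry.Lorentzian

namespace Summit.FinalStateConjecture.FinalStateConjecture.Theorems.StarvedNecks.Broom

/-- **Far-clean admissible data are self-broomed.** If `d ∈ admissibleVacuumData X` is far-clean to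
order `(6, 5)` with mass `M` on a sole end `e` (`e.IsStronglyAsymptoticallyFlatWith d M 1 2 6 5`), then
the conclusion of `stub_broom` holds at `d`: witness the breathing curve of `d` on a coordinate ball far
out on `e`, read on the collared end `e.restrict _` (tame by
`AFEnd.isTameDataFamily_restrict_breatheCurve`, immersed, injective, admissible by
`TameBreathingCurve.lean`); every member agrees with `d` off the compact breathing core, so it is
far-clean on `e` with the same mass, and far-cleanness is unchanged by the collar.
[cite: Christodoulou1999, p. A24] -/
theorem broom_of_farClean : ∀ {X : Type} [TopologicalSpace X] [ChartedSpace E3 X] [IsManifold (𝓡 3) ∞ X] [T2Space X] [SecondCountableTopology X] [ConnectedSpace X] {d : InitialDataSet (𝓡 3) X}, d ∈ admissibleVacuumData X → ∀ {e : AFEnd X}, e.IsSoleEnd → ∀ {M : ℝ}, e.IsStronglyAsymptoticallyFlatWith d M 1 2 6 5 → ∃ (e' : AFEnd X) (F : EuclideanSpace ℝ (Fin 1) → InitialDataSet (𝓡 3) X), InitialDataSet.IsTameDataFamily e' 1 F ∧ InitialDataSet.IsImmersedAtZero 1 F ∧ F 0 = d ∧ Function.Injective F ∧ (∀ c, F c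 ∈ admissibleVacuumData X) ∧ ∀ c ≠ 0, ∃ M : ℝ, e'.IsStronglyAsymptoticallyFlatWith (F c) M 1 2 6 5 := by
  intro X _ _ _ _ _ _ d hd e he M hclean
  -- DR-flatness of `d` on `e` (drop derivative counts `6 ↦ 2`, `5 ↦ 1`)
  have hDR : e.IsStronglyAsymptoticallyFlatDR d M := hclean.mono_count (by norm_num) (by norm_num)
  -- a breathing ball far out on the end (as in `InitialDataSet.exists_tame_selfWitness`)
  set z₀ : E3 := (e.R + 3) • EuclideanSpace.single (0 : Fin 3) (1 : ℝ) with hz₀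
  have hz₀n : ‖z₀‖ = e.R + 3 := by
    rw [hz₀, norm_smul, PiLp.norm_single, norm_one, mul_one,
      Real.norm_of_nonneg (by linarith [e.R_pos])]
  have B : e.BreathingData z₀ 1 := ⟨one_pos, by rw [hz₀n]; linarith⟩
  have hR₁ : e.R < e.R + 1 := by linarith
  -- a far region of `e` missing the compact breathing core, on which all members agree with `d`
  obtain ⟨R₀, hR₀⟩ := e.exists_forall_far_disjoint (AFEnd.isCompact_breatheCore B)
  have hagree : ∀ (c : EuclideanSpace ℝ (Fin 1)), ∀ q ∈ e.far R₀,
      (AFEnd.breatheFamily B d (c 0)).h.inner q = d.h.inner q ∧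
        (AFEnd.breatheFamily B d (c 0)).k q = d.k q :=
    fun c q hq ↦ AFEnd.breatheFamily_eq_of_not_mem_core B d (c 0)
      (fun hqK ↦ Set.disjoint_left.1 (hR₀ R₀ le_rfl) hq hqK)
  refine ⟨e.restrict hR₁.le, fun c ↦ AFEnd.breatheFamily B d (c 0),
    AFEnd.isTameDataFamily_restrict_breatheCurve B d he hDR hR₁,
    AFEnd.isImmersedAtZero_breatheCurve B d, AFEnd.breatheCurve_zero B d,
    AFEnd.injective_breatheCurve B d, fun c ↦ AFEnd.breatheCurve_mem_admissibleVacuumData B d hd c,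
    fun c _ ↦ ⟨M, ?_⟩⟩
  rw [e.isStronglyAsymptoticallyFlatWith_restrict_iff hR₁.le]
  exact hclean.congr_of_eqOn_far (R₀ := R₀) (fun q hq ↦ (hagree c q hq).1) (fun q hq ↦ (hagree c q hq).2)

/-- **Arc-locality of the broom.** A tame, immersed, injective curve of admissible data through `d`
whose members with `0 < ‖c‖ < ε` are far-clean to order `(6, 5)` on the end yields one (same end, same
base datum) all of whose members off `0` are far-clean: the radial reparametrisation of
`InitialDataSet.exists_tameFamily_of_local`. So any construction of brooms need only control small
parameters. [cite: Christodoulou1999, p. A24] -/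
theorem broom_of_local : ∀ {X : Type} [TopologicalSpace X] [ChartedSpace E3 X] [IsManifold (𝓡 3) ∞ X] {d : InitialDataSet (𝓡 3) X} {e : AFEnd X} {F : EuclideanSpace ℝ (Fin 1) → InitialDataSet (𝓡 3) X}, InitialDataSet.IsTameDataFamily e 1 F → InitialDataSet.IsImmersedAtZero 1 F → F 0 = d → Function.Injective F → (∀ c, F c ∈ admissibleVacuumData X) → ∀ {ε : ℝ}, 0 < ε → (∀ c, c ≠ 0 → ‖c‖ < ε → ∃ M : ℝ, e.IsStronglyAsymptoticallyFlatWith (F c) M 1 2 6 5) → ∃ (e' : AFEnd X) (F' : EuclideanSpace ℝ (Fin 1) → InitialDataSet (𝓡 3) X), InitialDataSet.IsTameDataFamily e' 1 F' ∧ InitialDataSet.IsImmersedAtZero 1 F' ∧ F' 0 = d ∧ Function.Injective F' ∧ (∀ c, F' c ∈ admissibleVacuumData X) ∧ ∀ c ≠ 0, ∃ M : ℝ, e'.IsStronglyAsymptoticallyFlatWith (F' c) M 1 2 6 5 := by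
  intro X _ _ _ d e F hF himm h0 hinj h𝓓 ε hε hclean
  obtain ⟨F', hF', hF'0, hinj', himm', h𝓓', hP'⟩ :=
    InitialDataSet.exists_tameFamily_of_local
      (P := fun D ↦ ∃ M : ℝ, e.IsStronglyAsymptoticallyFlatWith D M 1 2 6 5) hF himm hinj h𝓓 hε hclean
  exact ⟨e, F', hF', himm', hF'0.trans h0, hinj', h𝓓', hP'⟩

end Summit.FinalStateConjecture.FinalStateConjecture.Theorems.StarvedNecks.Broom

end
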